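/-
Origin: expansion seat `prover-pub-hodgecm-mc-binder-1-g17-0`, handover #R115r2 2026-08-20T22:31:33Z md5 5511b9a68bb4 (97 l.; REPLACE of HodgeCM/Model/HThetaOfTower.lean — PKG file now bee6f081dbfa (101 l., incl. packager Origin header); body of record 155e97306309 (97 l.) → 5511b9a68bb4; owner binder-1 #R115 (RUN 63); token strike only; NAMES for audit: HodgeCM.Model.subset_span_of_liuDictionary_of_below · HodgeCM.Model.subset_span_of_tower) (`HOME/mc/pub-hodgecm-mc-binder-1-g17/campaign/new/HThetaOfTower.lean`, md5 5511b9a68bb4, 97 lines);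
landed by the gen-27 packager (p-g27) in gate run 65 REPLACES the earlier landed copy of `HodgeCM/Model/HThetaOfTower.lean` (verbatim).
-/
/-
Copyright (c) 2026 the pub-hodgecm formalisation cell (harness21).  New file, not vendored.
Origin: session prover-pub-hodgecm-mc-binder-1-g16-0 (unit pub-hodgecm-mc-binder-1-g16, BINDER PROVER gen 16 of lineage mc-binder-1;
content lane (J-Liu-Θ), (J3) — the junction of `Model/LiuDictionary` (RUN 62) SPECIALISED to the tower instance `LiuDictionary.ofTower`:
what row 9's `hΘ`/`hsmall` still asks of the (J4) side and of the desk), 2026-08-20.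
-/
import Summits.HodgeConjecture.HodgeCM.Model.LiuDictionaryTower

/-!
# Row 9 through the tower: the junction with `H := Tower`, `res := resTotal`

axioms-1-g15's junction `Model.subset_span_of_liuDictionary` (RUN 62) takes `hIso` at EVERY level `Γ : Level V`; the tower supplies
identity-component restrictions only at the levels of its index set (`Γ.BelowConjThree`).  Since the conclusion is `∃ Γ₀, ∀ Γ ≤ Γ₀, …`,
this costs nothing: run the junction on the family `Θ` EMPTIED off the index set and intersect the threshold with `Level.three`.

* `subset_span_of_liuDictionary_of_below` — the junction with `hIso` asked only at levels below a conjugate of `K_f(3)`;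
* **`subset_span_of_tower`** — the junction for `T := LiuDictionary.ofTower … Char Adm Ω PhiMu adm` with `hIso` DISCHARGED by
  `hIso_of_families`: its remaining inputs are (a) the cited sentences about the adèlic carriers (`Irreducible`, `Prop413`, `Thm418_2`,
  `MuSeparated`) and r8 `Thm418C` (about `Tower`/`resTotal`/`adm`), (b) the corner match `hcorner` ((J5), binder-2), and
  (c) **the (J4) families**: for every tower level `Γ` and every `ω ∈ Θ Γ`, a family `c ∈ towerLevel … Γ hΓ` of component classes with
  `TowerLevel.res c = ω` whose image `ofLevel Γ hΓ c` lies in `⨆ μ ∈ S, block μ` (sinst-1's seam `Model/AdelicThetaTowerClass`).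
-/

noncomputable section

open Function Set
open NumberField
open Literature.AlgebraicGeometry.Motives
open Literature.AlgebraicGeometry.ShimuraVarieties
open Literature.AlgebraicGeometry.HodgeTheory
open Literature.NumberTheory.Automorphic
open Literature.NumberTheory.Automorphic.PicardCM
open Literature.NumberTheory.Transcendental (Arapura2012_Cor_15_4_6)

namespace HodgeCM.Model

open HodgeCM.Model.TowerLevel HodgeCM.Model.TowerCarrier HodgeCM.Literature.Theta HodgeCM.Literature.Theta.LiuAlbaneseModuleDatum

variable {hHD : exists_isReal_hodgeModel} {hI : hodgePQ_independent_of_hodgeModel}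
  {h₁ : BallQuotientUniformised} {h₃ : CMAbelianVarietyRealised}
variable {L : CMField} {ι₁ : L →+* ℂ} {V : HermSpace3 L ι₁}

/-- **The junction with `hIso` asked only on the tower's index set** (levels below a conjugate of `K_f(3)`). -/
theorem subset_span_of_liuDictionary_of_below (T : LiuDictionary hHD hI h₁ h₃ V)
    (hirr : T.Irreducible) (h413 : T.Prop413) (h4182 : T.Thm418_2) (hμ : T.MuSeparated) (h418 : T.Thm418C)
    {K : CMField} {Ψ : CMType K} {σ : K →+* ℂ}
    (S : Finset T.Char) (hΦ : ∀ μ ∈ S, T.PhiMu μ)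
    (hcorner : ∀ μ ∈ S, ∀ d : LiuCMSide, T.adm μ d → d.IsCorner K Ψ σ)
    (Θ : ∀ Γ : Level V, Set ((picardCMUniverse hHD hI h₁ h₃).CohC ((picardCMUniverse hHD hI h₁ h₃).pms L ι₁ V Γ) 1))
    (hIso : ∀ (Γ : Level V), Γ.BelowConjThree → ∀ ω ∈ Θ Γ, ∃ x : T.H,
      x ∈ fixedBy Γ.K T.H ∧ T.res Γ x = ω ∧ x ∈ ⨆ μ ∈ S, T.block μ) :
    ∃ Γ₀ : Level V, ∀ Γ ≤ Γ₀,
      Θ Γ ⊆ Submodule.span ℂ (⋃ D : CommonReflexInput K Ψ σ, D.surfaceClasses hHD hI h₁ h₃ V Γ) := by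
  classical
  let Θ' : ∀ Γ : Level V, Set ((picardCMUniverse hHD hI h₁ h₃).CohC ((picardCMUniverse hHD hI h₁ h₃).pms L ι₁ V Γ) 1) :=
    fun Γ ↦ if Γ.BelowConjThree then Θ Γ else ∅
  have hIso' : ∀ (Γ : Level V), ∀ ω ∈ Θ' Γ, ∃ x : T.H, x ∈ fixedBy Γ.K T.H ∧ T.res Γ x = ω ∧ x ∈ ⨆ μ ∈ S, T.block μ := by
    intro Γ ω hω
    by_cases hΓ : Γ.BelowConjThree
    · have hω' : ω ∈ Θ Γ := by simpa only [Θ', if_pos hΓ] using hω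
      exact hIso Γ hΓ ω hω'
    · simp only [Θ', if_neg hΓ, Set.mem_empty_iff_false] at hω
  obtain ⟨Γ₀, hΓ₀⟩ := subset_span_of_liuDictionary T hirr h413 h4182 hμ h418 S hΦ hcorner Θ' hIso'
  refine ⟨Γ₀ ⊓ Level.three V, fun Γ hΓ ω hω ↦ ?_⟩
  have hb : Γ.BelowConjThree := Level.belowConjThree_of_le_three (hΓ.trans inf_le_right)
  have hω' : ω ∈ Θ' Γ := by simpa only [Θ', if_pos hb] using hω
  exact hΓ₀ Γ (hΓ.trans inf_le_left) hω'

/-- **ROW 9 THROUGH THE TOWER.**  The junction for the dictionary `LiuDictionary.ofTower` (`H := Tower … V`, `res := resTotal …`):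
`hIso` is DISCHARGED from the (J4) families `hfam`; what remains are the cited sentences (`hirr h413 h4182 hμ` about the adèlic
carriers, `h418` = r8 about `Tower`/`resTotal`/`adm`), the corner match `hcorner`, and `hfam` itself. -/
theorem subset_span_of_tower (hA : Arapura2012_Cor_15_4_6)
    (Char : Type) (Adm : Char → Type) (Ω : (μ : Char) → Adm μ → Type)
    [∀ μ a, AddCommGroup (Ω μ a)] [∀ μ a, Module ℂ (Ω μ a)] [∀ μ a, Module (adelicAlgebra V) (Ω μ a)]
    [∀ μ a, IsScalarTower ℂ (adelicAlgebra V) (Ω μ a)] (PhiMu : Char → Prop) (adm : Char → LiuCMSide → Prop)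
    (hirr : (LiuDictionary.ofTower hHD hI h₁ h₃ hA V Char Adm Ω PhiMu adm).Irreducible)
    (h413 : (LiuDictionary.ofTower hHD hI h₁ h₃ hA V Char Adm Ω PhiMu adm).Prop413)
    (h4182 : (LiuDictionary.ofTower hHD hI h₁ h₃ hA V Char Adm Ω PhiMu adm).Thm418_2)
    (hμ : (LiuDictionary.ofTower hHD hI h₁ h₃ hA V Char Adm Ω PhiMu adm).MuSeparated)
    (h418 : (LiuDictionary.ofTower hHD hI h₁ h₃ hA V Char Adm Ω PhiMu adm).Thm418C)
    {K : CMField} {Ψ : CMType K} {σ : K →+* ℂ}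
    (S : Finset Char) (hΦ : ∀ μ ∈ S, PhiMu μ) (hcorner : ∀ μ ∈ S, ∀ d : LiuCMSide, adm μ d → d.IsCorner K Ψ σ)
    (Θ : ∀ Γ : Level V, Set ((picardCMUniverse hHD hI h₁ h₃).CohC ((picardCMUniverse hHD hI h₁ h₃).pms L ι₁ V Γ) 1))
    (hfam : ∀ (Γ : Level V) (hΓ : Γ.BelowConjThree), ∀ ω ∈ Θ Γ,
      ∃ c : towerLevel hHD hI (ballQuotientUniformisedDatum_of h₁) h₃ hA Γ hΓ,
        TowerLevel.res hHD hI (ballQuotientUniformisedDatum_of h₁) h₃ hA c = ω ∧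
          (ofLevel hHD hI (ballQuotientUniformisedDatum_of h₁) h₃ hA Γ hΓ c :
              (LiuDictionary.ofTower hHD hI h₁ h₃ hA V Char Adm Ω PhiMu adm).H) ∈
            ⨆ μ ∈ S, (LiuDictionary.ofTower hHD hI h₁ h₃ hA V Char Adm Ω PhiMu adm).block μ) :
    ∃ Γ₀ : Level V, ∀ Γ ≤ Γ₀,
      Θ Γ ⊆ Submodule.span ℂ (⋃ D : CommonReflexInput K Ψ σ, D.surfaceClasses hHD hI h₁ h₃ V Γ) :=
  subset_span_of_liuDictionary_of_below (LiuDictionary.ofTower hHD hI h₁ h₃ hA V Char Adm Ω PhiMu adm) hirr h413 h4182 hμ h418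
    S hΦ hcorner Θ fun Γ hΓ ↦ LiuDictionary.hIso_of_families hHD hI h₁ h₃ hA Char Adm Ω PhiMu adm S Θ Γ hΓ (hfam Γ hΓ)

end HodgeCM.Model

end
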